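import Summits.ResolutionOfSingularities.ResolutionOfSingularities.Theses.DefectlessFrames

/-!
# Disproof of `DefectlessFramesR` — findings (cdisprove seat, cycle 1, 2026-08-17)

Crux `DefectlessFrames.DefectlessFramesR` (stmt-ResolutionOfSingularities-17921): along a rank-one
zero-dimensional valuation ring `O ⊇ k` of a finitely generated `K/k`, `k` PERFECT of
characteristic `p`, every hypersurface frame `(y; z; f)` (`y` algebraically independent,
`k(y, z) = K`, `span {f} = ker`, `f ≠ 0`) is dominated by an integral hypersurface frame in general
position, axis order not increased, with `K/k(y')` SEPARABLE and DEFECTLESS at `O`.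

VERDICT OF THIS CYCLE: NO KILL.  LANDED (kernel-checked, definition-free copies of §A/§B/§D, namespace
`…Theorems`, importable by ideators/planners/provers):
`Theorems/DefectlessFramesR/Negative/FalseWithoutFNeZero.lean` (p150794 @49a49e456e8b),
`Theorems/DefectlessFramesR/Negative/FalseWithoutPerfectField.lean` (p150708 @79a488895252),
`Theorems/DefectlessFramesR/Negative/FalseWithFixedY.lean` (p150749 @e5fb73d2b179).

What is recorded here (prose only in docstrings):

* `§A` LOAD-BEARING `f ≠ 0` — `DefectlessFramesRWithoutFNeZero` (the crux with `f ≠ 0 →` deleted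
  = the rev-2 statement stmt-19085) is FALSE: `defectlessFramesR_false_without_f_ne_zero`
  (witness `k = 𝔽₂`, `K = 𝔽₂(X)`, `O` the `X`-adic ring, `n = 0`, `z = X`, `f = 0`).  The tree's
  rev-2 refutation file no longer elaborates (its target decl was retired), so the negative
  knowledge is re-landed here against an explicit restatement.
* `§B` LOAD-BEARING `PerfectField k` — `DefectlessFramesRWithoutPerfectField` is FALSE:
  `defectlessFramesR_false_without_perfectField` (witness `k = 𝔽₂(u²) ⊂ k' = 𝔽₂(u)`,
  `K = k'(t)`, `O` the `t`-adic ring, frame `(t; u)`, `f = X₁² - u²`: `u` is purely inseparable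
  over every `k(y')`, so no generating `z'` is separable over `k(y')`).  Any proof must route the
  separability conjunct through perfectness of `k`.
* `§C` WHY IT RESISTS (paper analysis, module docblock `§C` below; nothing there is a theorem).
* `§D` A NATURAL STRENGTHENING IS FALSE — `DefectlessFramesRFixedY` (conclusion with `y' = y`
  added: only the primitive element `z` and the relation `f` may be re-chosen) fails over the
  PERFECT field `𝔽₂`: `defectlessFramesR_false_with_fixed_y` (genuine frame `K = 𝔽₂(τ)`, `O`
  the `τ`-adic ring, `n = 1`, `y₀ = τ²`, `z = τ`, `f = X₁² - X₀`, axis order `s = 2 = p`;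
  `K/k(τ²)` is purely inseparable).  So the transcendence basis MUST move (Zariski A.IV / Nagata
  twist); by-product: a kernel-checked certificate that the hypotheses of the crux are met by a
  genuine frame with `n = 1`, `s = 2` (non-vacuity beyond the `s = 1` / `n = 0` corners).

Hypothesis ledger (drop one at a time): `f ≠ 0` ⇒ FALSE (§A); `PerfectField k` ⇒ FALSE (§B);
`adjoin k (range y ∪ {z}) = ⊤` ⇒ FALSE trivially (it alone pins `n = trdeg_k K`; witness `n = 0`,
`z = 1`, `K = 𝔽₂(X)` — not formalised, no content); `(⊤ : IntermediateField k K).FG` ⇒ redundant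
(implied by the frame); `AlgebraicIndependent y` ⇒ possibly unnecessary (with `span {f} = ker`
principal and `k(y,z) = K` it only excludes frames whose conclusion is met by the trivial
re-framing); `Nonempty RankOne` ⇒ the corner `n = 0` becomes reachable but is TRUE there (trivial
`O = K`, `e = f = 1`); zero-dimensionality / rank one ⇒ not attackable cheaply (rank-one places of
residue-transcendence-degree `trdeg - 1` and composite discrete places are Abhyankar, hence
defectless).
-/

set_option linter.dupNamespace false

open scoped Polynomial
open IsDedekindDomain.HeightOneSpectrum

namespace Summit.ResolutionOfSingularities.ResolutionOfSingularities.Cruxes.DefectlessFramesR.Disproof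

noncomputable section

/-! ## Witness infrastructure: the `X`-adic place of a rational function field `F(X)` -/

-- The `X`-adic valuation on `F(X)` and its valuation ring `F[X]_{(X)}` — NOTATIONS, not defs, so
-- that the landed `Negative/` copies of these lemmas stay definition-free (kernel-reviewed).
local notation "vX[" F "]" =>
  IsDedekindDomain.HeightOneSpectrum.valuation (RatFunc F) (Polynomial.idealX F)
local notation "OX[" F "]" =>
  Valuation.valuationSubring (IsDedekindDomain.HeightOneSpectrum.valuation (RatFunc F) (Polynomial.idealX F))

section Witness

variable (F : Type) [Field F]


/-- `X ∈ F[X]_{(X)}`. [folklore] -/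
theorem X_mem_OX : (RatFunc.X : RatFunc F) ∈ OX[F] := by
  rw [Valuation.mem_valuationSubring_iff]
  change vX[F] RatFunc.X ≤ 1
  rw [Polynomial.valuation_X_eq_neg_one, ← WithZero.exp_zero, WithZero.exp_le_exp]
  decide

/-- Polynomials lie in `F[X]_{(X)}`. [folklore] -/
theorem polynomial_mem_OX (q : F[X]) : algebraMap F[X] (RatFunc F) q ∈ OX[F] := by
  rw [Valuation.mem_valuationSubring_iff]
  exact valuation_le_one _ _

/-- Constants lie in `F[X]_{(X)}`. [folklore] -/
theorem const_mem_OX (c : F) : algebraMap F (RatFunc F) c ∈ OX[F] := by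
  rw [IsScalarTower.algebraMap_apply F F[X] (RatFunc F)]
  exact polynomial_mem_OX F _

/-- The valuation of `OX` is equivalent to the `X`-adic valuation. [folklore] -/
theorem isEquiv_OX : vX[F].IsEquiv OX[F].valuation := Valuation.isEquiv_valuation_valuationSubring _

/-- `F[X]_{(X)}` has rank one. [folklore] -/
theorem rankOne_OX : Nonempty OX[F].valuation.RankOne := by
  haveI : OX[F].valuation.IsNontrivial := by
    refine ⟨RatFunc.X, ?_, ?_⟩
    · simp [RatFunc.X_ne_zero]
    · intro h1
      have := ((isEquiv_OX F).symm.eq_one_iff_eq_one).mp h1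
      simp [Polynomial.valuation_X_eq_neg_one] at this
  rw [Valuation.nonempty_rankOne_iff_mulArchimedean]
  haveI h1 : MulArchimedean (MonoidWithZeroHom.ValueGroup₀ (.ofClass vX[F])) :=
    MulArchimedean.comap MonoidWithZeroHom.ValueGroup₀.embedding.toMonoidHom
      MonoidWithZeroHom.ValueGroup₀.embedding_strictMono
  exact MulArchimedean.comap ((isEquiv_OX F).symm.orderMonoidIso).toMonoidHom
    ((isEquiv_OX F).symm.orderMonoidIso).strictMono

/-- Every element of `F[X]_{(X)}` is congruent to a constant of `F` modulo the maximal ideal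
(the residue field is `F`). [folklore] -/
theorem exists_const_sub_lt_one (x : RatFunc F) (hx : x ∈ OX[F]) :
    ∃ c : F, vX[F] (x - algebraMap F (RatFunc F) c) < 1 := by
  rw [Valuation.mem_valuationSubring_iff] at hx
  have hd : x.denom ≠ 0 := RatFunc.denom_ne_zero x
  have hd' : algebraMap F[X] (RatFunc F) x.denom ≠ 0 := RatFunc.algebraMap_ne_zero hd
  -- the denominator is not divisible by `X`
  have hd0 : x.denom.coeff 0 ≠ 0 := by
    intro h0
    have hXd : Polynomial.X ∣ x.denom := Polynomial.X_dvd_iff.mpr h0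
    have hvd : (Polynomial.idealX F).intValuation x.denom < 1 :=
      (intValuation_lt_one_iff_mem _ _).mpr
        (by rw [Polynomial.idealX_span]; exact Ideal.mem_span_singleton.mpr hXd)
    have hXn : ¬ Polynomial.X ∣ x.num := by
      intro hXn
      obtain ⟨a, b, hab⟩ := RatFunc.isCoprime_num_denom x
      have : Polynomial.X ∣ (1 : F[X]) := hab ▸ dvd_add (dvd_mul_of_dvd_right hXn a)
        (dvd_mul_of_dvd_right hXd b)
      exact Polynomial.not_isUnit_X (isUnit_of_dvd_one this)
    have hvn : (Polynomial.idealX F).intValuation x.num = 1 :=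
      intValuation_eq_one_iff.mpr
        (by rw [Polynomial.idealX_span]; exact fun h => hXn (Ideal.mem_span_singleton.mp h))
    have hvx : vX[F] x = 1 / (Polynomial.idealX F).intValuation x.denom := by
      conv_lhs => rw [← RatFunc.num_div_denom x]
      rw [map_div₀, valuation_of_algebraMap, valuation_of_algebraMap, hvn]
    have hpos : 0 < (Polynomial.idealX F).intValuation x.denom :=
      zero_lt_iff.mpr (intValuation_ne_zero _ _ hd)
    have : 1 < vX[F] x := by
      rw [hvx, one_div, one_lt_inv₀ hpos]; exact hvd
    exact absurd hx (not_le.mpr this)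
  have hvd : (Polynomial.idealX F).intValuation x.denom = 1 :=
    intValuation_eq_one_iff.mpr (by
      rw [Polynomial.idealX_span]
      exact fun h => hd0 (Polynomial.X_dvd_iff.mp (Ideal.mem_span_singleton.mp h)))
  set c : F := x.num.coeff 0 / x.denom.coeff 0 with hc
  refine ⟨c, ?_⟩
  have hx' : x - algebraMap F (RatFunc F) c =
      algebraMap F[X] (RatFunc F) (x.num - Polynomial.C c * x.denom) / algebraMap F[X] (RatFunc F) x.denom := by
    rw [map_sub, map_mul, sub_div, mul_div_assoc, div_self hd', mul_one,
      IsScalarTower.algebraMap_apply F F[X] (RatFunc F) c, Polynomial.algebraMap_eq, RatFunc.num_div_denom]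
  rw [hx', map_div₀, valuation_of_algebraMap, valuation_of_algebraMap, hvd, div_one,
    intValuation_lt_one_iff_mem, Polynomial.idealX_span, Ideal.mem_span_singleton,
    Polynomial.X_dvd_iff]
  simp [hc, div_mul_cancel₀ _ hd0]

/-- `F[X]_{(X)}` is zero-dimensional over `F`: every residue is a root of a nonzero polynomial
over `F` (namely `X - c`). [folklore] -/
theorem zeroDim_OX (x : RatFunc F) (hx : x ∈ OX[F]) :
    ∃ g : Polynomial F, g ≠ 0 ∧ Polynomial.aeval x g ∈ OX[F].nonunits := by
  obtain ⟨c, hc⟩ := exists_const_sub_lt_one F x hx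
  refine ⟨Polynomial.X - Polynomial.C c, Polynomial.X_sub_C_ne_zero c, ?_⟩
  rw [ValuationSubring.mem_nonunits_iff, ← (isEquiv_OX F).lt_one_iff_lt_one]
  simpa only [map_sub, Polynomial.aeval_X, Polynomial.aeval_C] using hc

/-- `F(X)` is finitely generated over `F`. [folklore] -/
theorem fg_top : (⊤ : IntermediateField F (RatFunc F)).FG := ⟨{RatFunc.X}, by simp [RatFunc.adjoin_X]⟩

end Witness

/-! ## §A  `f ≠ 0` is load-bearing (re-landing of the rev-2 refutation) -/

/-- `DefectlessFramesR` with the hypothesis `f ≠ 0 →` DELETED (verbatim the retired rev-2 crux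
`DefectlessFrames`, stmt-ResolutionOfSingularities-19085). [folklore] -/
def DefectlessFramesRWithoutFNeZero : Prop :=
  ∀ p : ℕ, p.Prime → ∀ (k K : Type) [Field k] [CharP k p] [PerfectField k] [Field K] [Algebra k K], (⊤ : IntermediateField k K).FG → ∀ O : ValuationSubring K, ∀ hk : (∀ c : k, algebraMap k K c ∈ O), Nonempty O.valuation.RankOne → (∀ x ∈ O, ∃ f : Polynomial k, f ≠ 0 ∧ Polynomial.aeval x f ∈ O.nonunits) → let ρ : k →+* IsLocalRing.ResidueField O := (IsLocalRing.residue O).comp ((algebraMap k K).codRestrict O hk); let axis : (m : ℕ) → (Fin m → O) → MvPolynomial (Fin (m + 1)) k → Polynomial (IsLocalRing.ResidueField O) := fun _ w g => MvPolynomial.eval₂ (Polynomial.C.comp ρ) (Fin.snoc (fun j => Polynomial.C (IsLocalRing.residue O (w j))) Polynomial.X) g; ∀ (n : ℕ) (y : Fin n → O) (z : O) (f : MvPolynomial (Fin (n + 1)) k), AlgebraicIndependent k (fun i => (y i : K)) → IntermediateField.adjoin k (Set.range (fun i => (y i : K)) ∪ {(z : K)}) = ⊤ → Ideal.span {f} =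 RingHom.ker (MvPolynomial.aeval (Fin.snoc (fun i => (y i : K)) (z : K)) : MvPolynomial (Fin (n + 1)) k →ₐ[k] K) → ∃ (y' : Fin n → O) (z' : O) (f' : MvPolynomial (Fin (n + 1)) k), AlgebraicIndependent k (fun i => (y' i : K)) ∧ IsIntegral (Algebra.adjoin k (Set.range fun i => (y' i : K))) (z' : K) ∧ IntermediateField.adjoin k (Set.range (fun i => (y' i : K)) ∪ {(z' : K)}) = ⊤ ∧ Ideal.span {f'} = RingHom.ker (MvPolynomial.aeval (Fin.snoc (fun i => (y' i : K)) (z' : K)) : MvPolynomial (Fin (n + 1)) k →ₐ[k] K) ∧ (∀ i, (y i : K) ∈ Algebra.adjoin k (Set.range (fun i => (y' i : K)) ∪ {(z' : K)})) ∧ (z : K) ∈ Algebra.adjoin k (Set.range (fun i => (y' i : K)) ∪ {(z' : K)}) ∧ axis n y' f' ≠ 0 ∧ (axis n y f ≠ 0 → (axis n y' f').rootMultiplicity (IsLocalRing.residue O z') ≤ (axis n y f).rootMultiplicity (IsLocalRing.residue O z)) ∧ IsSeparable (IntermediateField.adjoin k (Set.range fun i => (y' i : K))) (z' : K) ∧ ∀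 (Ω : Type) [Field Ω] [Algebra K Ω] [IsAlgClosure K Ω] (V : ValuationSubring Ω), V.comap (algebraMap K Ω) = O → let F : Subfield Ω := (IntermediateField.adjoin k (Set.range fun i => (y' i : K))).toSubfield.map (algebraMap K Ω); let Fh : Subfield Ω := (IntermediateField.lift (IntermediateField.fixedField (ValuationSubring.decompositionSubgroup F (V.comap (algebraMap (separableClosure F Ω) Ω))))).toSubfield; let T : Subfield Ω := Fh ⊔ (algebraMap K Ω).fieldRange; Fh ≤ T ∧ 0 < Subfield.relfinrank Fh T ∧ Subfield.relfinrank Fh T = (Literature.AlgebraicGeometry.Resolution.valueSubgroup Fh V).relIndex (Literature.AlgebraicGeometry.Resolution.valueSubgroup T V) * (Literature.AlgebraicGeometry.Resolution.residueSubfield Fh V).relfinrank (Literature.AlgebraicGeometry.Resolution.residueSubfield T V)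

/-- **Any proof of `DefectlessFramesR` must use `f ≠ 0`.**  Without it the degenerate frame
`n = 0`, `z = X` transcendental, `f = 0` meets every hypothesis (`span {0} = ⊥ = ker`, as `X` is
transcendental), while the conclusion produces `z' ∈ O` integral over `k[y'] = k` (empty `y'`) with
`k(z') = K`, forcing `K/k` algebraic.  Witness `k = 𝔽₂`, `K = 𝔽₂(X)`, `O` the `X`-adic valuation
ring (rank one, residue field `𝔽₂`).  (Same witness as the tree's rev-2 refutation
`Theorems.DefectlessFramesDefectlessFrames_refuted`, whose target decl has since been retired.)
[folklore] -/
theorem defectlessFramesR_false_without_f_ne_zero : ¬ DefectlessFramesRWithoutFNeZero := by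
  intro h
  -- specialise the crux to the degenerate frame `n = 0`, `z = X`, `f = 0`
  have h1 := h 2 Nat.prime_two (ZMod 2) (RatFunc (ZMod 2)) (fg_top _) OX[ZMod 2] (const_mem_OX (ZMod 2))
    (rankOne_OX (ZMod 2)) (zeroDim_OX (ZMod 2))
  have hz : AlgebraicIndependent (ZMod 2) (fun i : Fin 0 => ((Fin.elim0 i : OX[ZMod 2]) : RatFunc (ZMod 2))) := by
    rw [algebraicIndependent_empty_type_iff]
    exact (algebraMap (ZMod 2) (RatFunc (ZMod 2))).injective
  have hadj : IntermediateField.adjoin (ZMod 2)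
      (Set.range (fun i : Fin 0 => ((Fin.elim0 i : OX[ZMod 2]) : RatFunc (ZMod 2))) ∪
        {((⟨RatFunc.X, X_mem_OX (ZMod 2)⟩ : OX[ZMod 2]) : RatFunc (ZMod 2))}) = ⊤ := by
    simp [Set.range_eq_empty, RatFunc.adjoin_X]
  have hker : Ideal.span {(0 : MvPolynomial (Fin (0 + 1)) (ZMod 2))} =
      RingHom.ker (MvPolynomial.aeval (Fin.snoc (fun i : Fin 0 => ((Fin.elim0 i : OX[ZMod 2]) : RatFunc (ZMod 2)))
        ((⟨RatFunc.X, X_mem_OX (ZMod 2)⟩ : OX[ZMod 2]) : RatFunc (ZMod 2))) :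
          MvPolynomial (Fin (0 + 1)) (ZMod 2) →ₐ[ZMod 2] RatFunc (ZMod 2)) := by
    rw [Ideal.span_singleton_eq_bot.mpr rfl, eq_comm, ← RingHom.injective_iff_ker_eq_bot]
    haveI : Subsingleton (Fin (0 + 1)) := inferInstanceAs (Subsingleton (Fin 1))
    have hsnoc : (Fin.snoc (fun i : Fin 0 => ((Fin.elim0 i : OX[ZMod 2]) : RatFunc (ZMod 2)))
        ((⟨RatFunc.X, X_mem_OX (ZMod 2)⟩ : OX[ZMod 2]) : RatFunc (ZMod 2)) : Fin (0 + 1) → RatFunc (ZMod 2)) =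
          fun _ => (RatFunc.X : RatFunc (ZMod 2)) := by
      funext i
      rw [Subsingleton.elim i (Fin.last 0), Fin.snoc_last]
    have : AlgebraicIndependent (ZMod 2) (fun _ : Fin (0 + 1) => (RatFunc.X : RatFunc (ZMod 2))) := by
      rw [algebraicIndependent_singleton_iff (0 : Fin (0 + 1))]
      exact RatFunc.transcendental_X
    rw [hsnoc]
    exact this
  obtain ⟨y', z', f', -, hint, hadj', -⟩ := h1 0 Fin.elim0 ⟨RatFunc.X, X_mem_OX (ZMod 2)⟩ 0 hz hadj hker
  -- `z'` is integral over `k` (the adjoin of the empty range is `⊥`)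
  have hint' : IsIntegral (ZMod 2) (z' : RatFunc (ZMod 2)) := by
    haveI : Algebra.IsIntegral (ZMod 2)
        (Algebra.adjoin (ZMod 2) (Set.range fun i : Fin 0 => (y' i : RatFunc (ZMod 2)))) :=
      Algebra.IsIntegral.adjoin (by simp)
    exact isIntegral_trans (z' : RatFunc (ZMod 2)) hint
  have hfin : FiniteDimensional (ZMod 2) (IntermediateField.adjoin (ZMod 2) {(z' : RatFunc (ZMod 2))}) :=
    IntermediateField.adjoin.finiteDimensional hint'
  have htop : IntermediateField.adjoin (ZMod 2) {(z' : RatFunc (ZMod 2))} = ⊤ := by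
    simpa [Set.range_eq_empty] using hadj'
  have hfinK : FiniteDimensional (ZMod 2) (RatFunc (ZMod 2)) := by
    haveI : FiniteDimensional (ZMod 2) (⊤ : IntermediateField (ZMod 2) (RatFunc (ZMod 2))) := by
      rw [← htop]; exact hfin
    exact LinearEquiv.finiteDimensional
      (IntermediateField.topEquiv (F := ZMod 2) (E := RatFunc (ZMod 2))).toLinearEquiv
  have hXint : IsIntegral (ZMod 2) (RatFunc.X : RatFunc (ZMod 2)) := IsIntegral.of_finite (ZMod 2) _
  exact RatFunc.transcendental_X hXint.isAlgebraic

/-! ## §B  `PerfectField k` is load-bearing -/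

/-- `DefectlessFramesR` with the instance hypothesis `[PerfectField k]` DELETED (everything else
verbatim). [folklore] -/
def DefectlessFramesRWithoutPerfectField : Prop :=
  ∀ p : ℕ, p.Prime → ∀ (k K : Type) [Field k] [CharP k p] [Field K] [Algebra k K], (⊤ : IntermediateField k K).FG → ∀ O : ValuationSubring K, ∀ hk : (∀ c : k, algebraMap k K c ∈ O), Nonempty O.valuation.RankOne → (∀ x ∈ O, ∃ f : Polynomial k, f ≠ 0 ∧ Polynomial.aeval x f ∈ O.nonunits) → let ρ : k →+* IsLocalRing.ResidueField O := (IsLocalRing.residue O).comp ((algebraMap k K).codRestrict O hk); let axis : (m : ℕ) → (Fin m → O) → MvPolynomial (Fin (m + 1)) k → Polynomial (IsLocalRing.ResidueField O) := fun _ w g => MvPolynomial.eval₂ (Polynomial.C.comp ρ) (Fin.snoc (fun j => Polynomial.C (IsLocalRing.residue O (w j))) Polynomial.X) g; ∀ (n : ℕ) (y : Fin n → O) (z : O) (f : MvPolynomial (Fin (n + 1)) k), AlgebraicIndependent k (fun i => (y i : K)) → IntermediateField.adjoin k (Set.range (fun i => (y i : K)) ∪ {(z : K)}) = ⊤ → Ideal.span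 {f} = RingHom.ker (MvPolynomial.aeval (Fin.snoc (fun i => (y i : K)) (z : K)) : MvPolynomial (Fin (n + 1)) k →ₐ[k] K) → f ≠ 0 → ∃ (y' : Fin n → O) (z' : O) (f' : MvPolynomial (Fin (n + 1)) k), AlgebraicIndependent k (fun i => (y' i : K)) ∧ IsIntegral (Algebra.adjoin k (Set.range fun i => (y' i : K))) (z' : K) ∧ IntermediateField.adjoin k (Set.range (fun i => (y' i : K)) ∪ {(z' : K)}) = ⊤ ∧ Ideal.span {f'} = RingHom.ker (MvPolynomial.aeval (Fin.snoc (fun i => (y' i : K)) (z' : K)) : MvPolynomial (Fin (n + 1)) k →ₐ[k] K) ∧ (∀ i, (y i : K) ∈ Algebra.adjoin k (Set.range (fun i => (y' i : K)) ∪ {(z' : K)})) ∧ (z : K) ∈ Algebra.adjoin k (Set.range (fun i => (y' i : K)) ∪ {(z' : K)}) ∧ axis n y' f' ≠ 0 ∧ (axis n y f ≠ 0 → (axis n y' f').rootMultiplicity (IsLocalRing.residue O z') ≤ (axis n y f).rootMultiplicity (IsLocalRing.residue O z)) ∧ IsSeparable (IntermediateField.adjoin k (Set.range fun i => (y' i :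 K))) (z' : K) ∧ ∀ (Ω : Type) [Field Ω] [Algebra K Ω] [IsAlgClosure K Ω] (V : ValuationSubring Ω), V.comap (algebraMap K Ω) = O → let F : Subfield Ω := (IntermediateField.adjoin k (Set.range fun i => (y' i : K))).toSubfield.map (algebraMap K Ω); let Fh : Subfield Ω := (IntermediateField.lift (IntermediateField.fixedField (ValuationSubring.decompositionSubgroup F (V.comap (algebraMap (separableClosure F Ω) Ω))))).toSubfield; let T : Subfield Ω := Fh ⊔ (algebraMap K Ω).fieldRange; Fh ≤ T ∧ 0 < Subfield.relfinrank Fh T ∧ Subfield.relfinrank Fh T = (Literature.AlgebraicGeometry.Resolution.valueSubgroup Fh V).relIndex (Literature.AlgebraicGeometry.Resolution.valueSubgroup T V) * (Literature.AlgebraicGeometry.Resolution.residueSubfield Fh V).relfinrank (Literature.AlgebraicGeometry.Resolution.residueSubfield T V)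

-- `𝔽₂(u)`, the subfield `𝔽₂(u²)` of its squares, `K = 𝔽₂(u)(t)` and the two frame elements
-- (notations, not defs)
local notation "𝕜'" => RatFunc (ZMod 2)
local notation "𝕜sq" => RingHom.fieldRange (frobenius (RatFunc (ZMod 2)) 2)
local notation "𝕂" => RatFunc (RatFunc (ZMod 2))
local notation "tK" => (RatFunc.X : RatFunc (RatFunc (ZMod 2)))
local notation "uK" => (algebraMap (RatFunc (ZMod 2)) (RatFunc (RatFunc (ZMod 2))) RatFunc.X)

/-- `u = X` is not a square in `𝔽₂(u)`: its `u`-adic value `exp (-1)` is not a square. [folklore] -/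
theorem X_ne_sq (w : 𝕜') : w ^ 2 ≠ (RatFunc.X : 𝕜') := by
  intro h
  have hv : (vX[ZMod 2] w) ^ 2 = WithZero.exp (-1 : ℤ) := by
    rw [← map_pow, h, Polynomial.valuation_X_eq_neg_one]
  have hw : vX[ZMod 2] w ≠ 0 := by
    intro h0
    rw [h0, zero_pow two_ne_zero] at hv
    exact WithZero.exp_ne_zero hv.symm
  have hl := congrArg WithZero.log hv
  rw [WithZero.log_pow, WithZero.log_exp, nsmul_eq_mul] at hl
  omega

/-- Hence `u ∉ 𝔽₂(u²)`. [folklore] -/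
theorem X_not_mem_sq : (RatFunc.X : 𝕜') ∉ 𝕜sq := fun hmem => by
  obtain ⟨w, hw⟩ := RingHom.mem_fieldRange.mp hmem
  exact X_ne_sq w (by rw [← hw, frobenius_def])

/-- Division with remainder by the monic-in-`X₁` relation `X₁² - a` in `k[X₀, X₁]`. [folklore] -/
theorem div_sq_sub_C {k : Type} [Field k] (a : k) (g : MvPolynomial (Fin (1 + 1)) k) :
    ∃ (q : MvPolynomial (Fin (1 + 1)) k) (r₀ r₁ : Polynomial k),
      g = q * (MvPolynomial.X 1 ^ 2 - MvPolynomial.C a) + Polynomial.aeval (MvPolynomial.X 0) r₀ +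
        Polynomial.aeval (MvPolynomial.X 0) r₁ * MvPolynomial.X 1 := by
  induction g using MvPolynomial.induction_on with
  | C c =>
    refine ⟨0, Polynomial.C c, 0, ?_⟩
    simp [MvPolynomial.algebraMap_eq]
  | add p q hp hq =>
    obtain ⟨q₁, r₀, r₁, rfl⟩ := hp
    obtain ⟨q₂, s₀, s₁, rfl⟩ := hq
    refine ⟨q₁ + q₂, r₀ + s₀, r₁ + s₁, ?_⟩
    simp only [map_add]
    ring
  | mul_X p i hp =>
    obtain ⟨q, r₀, r₁, rfl⟩ := hp
    fin_cases i
    · refine ⟨q * MvPolynomial.X 0, r₀ * Polynomial.X, r₁ * Polynomial.X, ?_⟩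
      simp only [Fin.zero_eta, map_mul, Polynomial.aeval_X]
      ring
    · refine ⟨q * MvPolynomial.X 1 + Polynomial.aeval (MvPolynomial.X 0) r₁, Polynomial.C a * r₁, r₀, ?_⟩
      simp only [Fin.mk_one, map_mul, Polynomial.aeval_C, MvPolynomial.algebraMap_eq]
      ring

/-- **Any proof of `DefectlessFramesR` must use `PerfectField k`.**  Over the IMPERFECT ground
field `k = 𝔽₂(u²)` take `k' = 𝔽₂(u) = k(u)` (purely inseparable of degree 2), `K = k'(t)`,
`O` = the `t`-adic valuation ring of `K` (rank one; residue field `k'`, algebraic over `k`), and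
the genuine hypersurface frame `n = 1`, `y₀ = t`, `z = u`, `f = X₁² - u² ≠ 0` (`k(t, u) = K`,
`span {f} = ker`).  The conclusion would give `y'₀` transcendental over `k` and `z'` SEPARABLE over
`k(y'₀)` with `k(y'₀, z') = K`; then `u` is separable over `k(y'₀)` and `u² ∈ k`, so
`u ∈ k(y'₀)`, i.e. `u = P(y'₀)/Q(y'₀)`, `u² Q² = P²` in `k[T]`, and comparing leading
coefficients makes `u²` a square in `k`, i.e. `u ∈ k` — absurd.  (So the separability conjunct is
unreachable without perfectness; defectlessness is not even reached.) [folklore] -/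
theorem defectlessFramesR_false_without_perfectField : ¬ DefectlessFramesRWithoutPerfectField := by
  intro h
  classical
  haveI : CharP 𝕜sq 2 := (Algebra.charP_iff 𝕜sq 𝕜' 2).mpr inferInstance
  have hsq_mem : ∀ w : 𝕜', w ^ 2 ∈ 𝕜sq := fun w => RingHom.mem_fieldRange.mpr ⟨w, frobenius_def ..⟩
  -- the element `a = u² ∈ k`
  obtain ⟨a, ha_val⟩ : ∃ a : 𝕜sq, (a : 𝕜') = RatFunc.X ^ 2 := ⟨⟨_, hsq_mem _⟩, rfl⟩
  have ha : algebraMap 𝕜sq 𝕂 a = uK ^ 2 := by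
    rw [IsScalarTower.algebraMap_apply 𝕜sq 𝕜' 𝕂, ← map_pow, ← ha_val]
    rfl
  -- constants of `k` lie in `O`
  have hconst : ∀ c : 𝕜sq, algebraMap 𝕜sq 𝕂 c ∈ OX[𝕜'] := fun c => by
    rw [IsScalarTower.algebraMap_apply 𝕜sq 𝕜' 𝕂]
    exact const_mem_OX _ _
  -- zero-dimensional over `k`: `x ≡ c (mod 𝔪)` with `c ∈ k'`, and `(x - c)² = x² - c²`, `c² ∈ k`
  have hzero : ∀ x ∈ OX[𝕜'], ∃ g : Polynomial 𝕜sq, g ≠ 0 ∧ Polynomial.aeval x g ∈ OX[𝕜'].nonunits := by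
    intro x hx
    obtain ⟨c, hc⟩ := exists_const_sub_lt_one _ x hx
    refine ⟨Polynomial.X ^ 2 - Polynomial.C ⟨c ^ 2, hsq_mem c⟩, Polynomial.X_pow_sub_C_ne_zero two_pos _, ?_⟩
    rw [ValuationSubring.mem_nonunits_iff, ← (isEquiv_OX _).lt_one_iff_lt_one]
    have hx2 : Polynomial.aeval x (Polynomial.X ^ 2 - Polynomial.C (⟨c ^ 2, hsq_mem c⟩ : 𝕜sq)) =
        (x - algebraMap 𝕜' 𝕂 c) ^ 2 := by
      rw [map_sub, map_pow, Polynomial.aeval_X, Polynomial.aeval_C,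
        IsScalarTower.algebraMap_apply 𝕜sq 𝕜' 𝕂, sub_pow_char x _, ← map_pow]
      rfl
    rw [hx2, map_pow]
    exact pow_lt_one₀ zero_le hc two_ne_zero
  -- `(⊤ : IntermediateField k K)` is generated by `t` and `u`
  have hgen : IntermediateField.adjoin 𝕜sq ({tK} ∪ {uK} : Set 𝕂) = ⊤ := by
    set A := IntermediateField.adjoin 𝕜sq ({tK} ∪ {uK} : Set 𝕂) with hA
    have huA : uK ∈ A := IntermediateField.subset_adjoin _ _ (Set.mem_union_right _ rfl)
    have htA : tK ∈ A := IntermediateField.subset_adjoin _ _ (Set.mem_union_left _ rfl)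
    -- every constant of `k' = 𝔽₂(u)` lies in `A`
    have hk' : ∀ c : 𝕜', algebraMap 𝕜' 𝕂 c ∈ A := by
      let T : IntermediateField (ZMod 2) 𝕜' :=
        { (A.toSubfield.comap (algebraMap 𝕜' 𝕂)) with
          algebraMap_mem' := fun r => by
            change algebraMap 𝕜' 𝕂 (algebraMap (ZMod 2) 𝕜' r) ∈ A
            rw [← ZMod.natCast_zmod_val r, map_natCast, map_natCast]
            exact natCast_mem A _ }
      have hXT : (RatFunc.X : 𝕜') ∈ T := huA
      have hT : (⊤ : IntermediateField (ZMod 2) 𝕜') ≤ T := by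
        rw [← RatFunc.adjoin_X]
        exact IntermediateField.adjoin_le_iff.mpr (Set.singleton_subset_iff.mpr hXT)
      intro c
      exact hT (IntermediateField.mem_top (x := c))
    let A' : IntermediateField 𝕜' 𝕂 := { A.toSubfield with algebraMap_mem' := hk' }
    have hA' : (⊤ : IntermediateField 𝕜' 𝕂) ≤ A' := by
      rw [← RatFunc.adjoin_X]
      exact IntermediateField.adjoin_le_iff.mpr (Set.singleton_subset_iff.mpr (show tK ∈ A' from htA))
    rw [eq_top_iff]
    intro x _
    exact hA' (IntermediateField.mem_top (x := x))
  have hfg : (⊤ : IntermediateField 𝕜sq 𝕂).FG := by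
    refine ⟨{tK, uK}, ?_⟩
    rw [Finset.coe_insert, Finset.coe_singleton, ← hgen, Set.singleton_union]
  -- specialise the crux
  have h1 := h 2 Nat.prime_two 𝕜sq 𝕂 hfg OX[𝕜'] hconst (rankOne_OX _) hzero
  -- the frame `(t; u)`, `f = X₁² - a`
  let y : Fin 1 → OX[𝕜'] := fun _ => ⟨tK, X_mem_OX _⟩
  let z : OX[𝕜'] := ⟨uK, const_mem_OX _ _⟩
  have hy : AlgebraicIndependent 𝕜sq (fun i => ((y i : OX[𝕜']) : 𝕂)) := by
    rw [algebraicIndependent_singleton_iff (0 : Fin 1)]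
    exact Transcendental.of_tower_top 𝕜sq (RatFunc.transcendental_X (K := 𝕜'))
  have hrange : Set.range (fun i => ((y i : OX[𝕜']) : 𝕂)) = {tK} := Set.range_const
  have hadj : IntermediateField.adjoin 𝕜sq (Set.range (fun i => ((y i : OX[𝕜']) : 𝕂)) ∪ {((z : OX[𝕜']) : 𝕂)}) = ⊤ := by
    rw [hrange]
    exact hgen
  have hv0 : (Fin.snoc (fun i => ((y i : OX[𝕜']) : 𝕂)) ((z : OX[𝕜']) : 𝕂) : Fin (1 + 1) → 𝕂) 0 = tK := rfl
  have hv1 : (Fin.snoc (fun i => ((y i : OX[𝕜']) : 𝕂)) ((z : OX[𝕜']) : 𝕂) : Fin (1 + 1) → 𝕂) 1 = uK := rfl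
  have hf0 : MvPolynomial.aeval (Fin.snoc (fun i => ((y i : OX[𝕜']) : 𝕂)) ((z : OX[𝕜']) : 𝕂) : Fin (1 + 1) → 𝕂)
      (MvPolynomial.X 1 ^ 2 - MvPolynomial.C a) = 0 := by
    rw [map_sub, map_pow, MvPolynomial.aeval_X, hv1, MvPolynomial.aeval_C, ha, sub_self]
  have hker : Ideal.span {MvPolynomial.X 1 ^ 2 - MvPolynomial.C a} =
      RingHom.ker (MvPolynomial.aeval (Fin.snoc (fun i => ((y i : OX[𝕜']) : 𝕂)) ((z : OX[𝕜']) : 𝕂)) :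
        MvPolynomial (Fin (1 + 1)) 𝕜sq →ₐ[𝕜sq] 𝕂) := by
    apply le_antisymm
    · rw [Ideal.span_le, Set.singleton_subset_iff, SetLike.mem_coe, RingHom.mem_ker]
      exact hf0
    · intro g hg
      rw [RingHom.mem_ker] at hg
      obtain ⟨q, r₀, r₁, rfl⟩ := div_sq_sub_C a g
      rw [map_add, map_add, map_mul, map_mul, hf0, mul_zero, zero_add, ← Polynomial.aeval_algHom_apply,
        ← Polynomial.aeval_algHom_apply, MvPolynomial.aeval_X, MvPolynomial.aeval_X, hv0, hv1,
        ← Polynomial.aeval_map_algebraMap 𝕜' tK r₀, ← Polynomial.aeval_map_algebraMap 𝕜' tK r₁,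
        RatFunc.aeval_X_left_eq_algebraMap, RatFunc.aeval_X_left_eq_algebraMap,
        IsScalarTower.algebraMap_apply 𝕜' (Polynomial 𝕜') 𝕂, Polynomial.algebraMap_eq, ← map_mul, ← map_add,
        map_eq_zero_iff _ (RatFunc.algebraMap_injective 𝕜')] at hg
      -- hg : r₀' + r₁' * C u = 0 in k'[T]; compare coefficients: r₁ ≠ 0 would put u in k
      have hcoeff : ∀ i, algebraMap 𝕜sq 𝕜' (r₀.coeff i) + algebraMap 𝕜sq 𝕜' (r₁.coeff i) * RatFunc.X = 0 := by
        intro i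
        have := congrArg (fun p => Polynomial.coeff p i) hg
        simpa only [Polynomial.coeff_add, Polynomial.coeff_mul_C, Polynomial.coeff_map,
          Polynomial.coeff_zero] using this
      have hr₁ : r₁ = 0 := by
        refine Polynomial.ext fun i => ?_
        rw [Polynomial.coeff_zero]
        by_contra hne
        have hne' : algebraMap 𝕜sq 𝕜' (r₁.coeff i) ≠ 0 :=
          (map_ne_zero_iff _ (algebraMap 𝕜sq 𝕜').injective).mpr hne
        apply X_not_mem_sq
        have hX : (RatFunc.X : 𝕜') = -(algebraMap 𝕜sq 𝕜' (r₀.coeff i)) / algebraMap 𝕜sq 𝕜' (r₁.coeff i) := by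
          rw [eq_div_iff hne', mul_comm, eq_neg_iff_add_eq_zero, add_comm]
          exact hcoeff i
        rw [hX]
        exact div_mem (neg_mem (r₀.coeff i).2) (r₁.coeff i).2
      have hr₀ : r₀ = 0 := by
        refine Polynomial.ext fun i => ?_
        have := hcoeff i
        rw [hr₁, Polynomial.coeff_zero, map_zero, zero_mul, add_zero,
          map_eq_zero_iff _ (algebraMap 𝕜sq 𝕜').injective] at this
        rw [Polynomial.coeff_zero]
        exact this
      simp only [hr₀, hr₁, map_zero, zero_mul, add_zero]
      exact Ideal.mul_mem_left _ q (Ideal.subset_span rfl)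
  have hf : (MvPolynomial.X 1 ^ 2 - MvPolynomial.C a : MvPolynomial (Fin (1 + 1)) 𝕜sq) ≠ 0 := by
    intro h0
    have ha0 : (a : 𝕜') ≠ 0 := by rw [ha_val]; exact pow_ne_zero 2 RatFunc.X_ne_zero
    have := congrArg (MvPolynomial.eval (fun _ : Fin (1 + 1) => (0 : 𝕜sq))) h0
    rw [map_sub, map_pow, MvPolynomial.eval_X, MvPolynomial.eval_C, map_zero, zero_pow two_ne_zero,
      zero_sub, neg_eq_zero] at this
    exact ha0 (by rw [this, ZeroMemClass.coe_zero])
  obtain ⟨y', z', f', hy', -, hadj', -, -, -, -, -, hsep, -⟩ := h1 1 y z _ hy hadj hker hf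
  -- `F₁ = k(y'₀)`, `K = F₁(z')` with `z'` separable, so `u` is separable over `F₁`
  generalize hF₁ : IntermediateField.adjoin 𝕜sq (Set.range fun i => ((y' i : OX[𝕜']) : 𝕂)) = F₁ at hsep
  have hzt : IntermediateField.adjoin F₁ {((z' : OX[𝕜']) : 𝕂)} = ⊤ := by
    rw [← IntermediateField.restrictScalars_eq_top_iff (K := 𝕜sq),
      IntermediateField.restrictScalars_adjoin, eq_top_iff, ← hadj', ← hF₁]
    exact IntermediateField.adjoin.mono _ _ _
      (Set.union_subset_union_left _ (IntermediateField.subset_adjoin _ _))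
  haveI hKsep : Algebra.IsSeparable F₁ (IntermediateField.adjoin F₁ {((z' : OX[𝕜']) : 𝕂)}) :=
    (IntermediateField.isSeparable_adjoin_simple_iff_isSeparable (F := F₁) (E := 𝕂)).mpr hsep
  have hsepu : IsSeparable F₁ uK := by
    have hu_top : uK ∈ IntermediateField.adjoin F₁ {((z' : OX[𝕜']) : 𝕂)} := by
      rw [hzt]; exact IntermediateField.mem_top
    exact IntermediateField.isSeparable_of_mem_isSeparable (F := F₁) (E := 𝕂) hu_top
  -- `u² = a ∈ k ⊆ F₁`: separable and purely inseparable, hence `u ∈ F₁`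
  have huF : uK ∈ F₁ := by
    have h1' : uK ∈ separableClosure F₁ 𝕂 := mem_separableClosure_iff.mpr hsepu
    have h2' : uK ∈ perfectClosure F₁ 𝕂 := by
      rw [mem_perfectClosure_iff_pow_mem 2]
      refine ⟨1, ⟨algebraMap 𝕜sq F₁ a, ?_⟩⟩
      rw [pow_one, ← IsScalarTower.algebraMap_apply, ha]
    have h3 : uK ∈ separableClosure F₁ 𝕂 ⊓ perfectClosure F₁ 𝕂 :=
      IntermediateField.mem_inf.mpr ⟨h1', h2'⟩
    rw [separableClosure_inf_perfectClosure, IntermediateField.mem_bot] at h3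
    obtain ⟨w, hw⟩ := h3
    rw [← hw]
    exact w.2
  -- `u ∈ k(y'₀)` with `y'₀` transcendental over `k`: write `u = r(y'₀)/s(y'₀)`
  have hy0 : Transcendental 𝕜sq ((y' 0 : OX[𝕜']) : 𝕂) :=
    (algebraicIndependent_singleton_iff (0 : Fin 1)).mp hy'
  have hrange' : Set.range (fun i => ((y' i : OX[𝕜']) : 𝕂)) = {((y' 0 : OX[𝕜']) : 𝕂)} := by
    rw [Set.range_unique]; rfl
  rw [← hF₁, hrange', IntermediateField.mem_adjoin_simple_iff] at huF
  obtain ⟨r, s, hrs⟩ := huF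
  by_cases hs : Polynomial.aeval ((y' 0 : OX[𝕜']) : 𝕂) s = 0
  · rw [hs, div_zero, map_eq_zero_iff _ (algebraMap 𝕜' 𝕂).injective] at hrs
    exact RatFunc.X_ne_zero hrs
  · -- `a s² = r²` in `k[T]`, so `a = (lc r / lc s)²` is a square in `k`, i.e. `u ∈ k`
    have hpoly : Polynomial.C a * s ^ 2 - r ^ 2 = 0 := by
      refine (transcendental_iff.mp hy0) _ ?_
      rw [eq_div_iff hs] at hrs
      rw [map_sub, map_mul, map_pow, map_pow, Polynomial.aeval_C, ha, ← mul_pow, hrs, sub_self]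
    have hs0 : s ≠ 0 := fun h0 => hs (by rw [h0, map_zero])
    have hlead := congrArg Polynomial.leadingCoeff (sub_eq_zero.mp hpoly)
    rw [Polynomial.leadingCoeff_mul, Polynomial.leadingCoeff_C, Polynomial.leadingCoeff_pow,
      Polynomial.leadingCoeff_pow] at hlead
    have hlc : s.leadingCoeff ≠ 0 := Polynomial.leadingCoeff_ne_zero.mpr hs0
    have hasq : a = (r.leadingCoeff / s.leadingCoeff) ^ 2 := by
      rw [div_pow, eq_div_iff (pow_ne_zero 2 hlc), hlead]
    apply X_not_mem_sq
    have hX : (RatFunc.X : 𝕜') = ((r.leadingCoeff / s.leadingCoeff : 𝕜sq) : 𝕜') := by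
      have h2 : ((RatFunc.X : 𝕜') - ((r.leadingCoeff / s.leadingCoeff : 𝕜sq) : 𝕜')) ^ 2 = 0 := by
        rw [sub_pow_char, sub_eq_zero, ← ha_val]
        exact_mod_cast congrArg Subtype.val hasq
      exact sub_eq_zero.mp (pow_eq_zero_iff two_ne_zero |>.mp h2)
    rw [hX]
    exact SetLike.coe_mem _

/-! ## §C  Why the crux resists (paper analysis; provers read this)

1. POLYNOMIAL-FRAME BOOKKEEPING IS FREE.  For any frame `(y; z; f)` with `n ≥ 1` put
   `y'ᵢ := yᵢ + z^{Nᵢ}`, `Nᵢ := M^{i+1}`, `M := p^e > deg f`, `z' := z`,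
   `f' := f(Y'₀ - Z^{N₀}, …, Z)`.  Then `k[y', z'] = k[y, z]` (domination both ways), `f'` is
   `unit · (monic in Z)` (Nagata: the `Z`-top term of `f'` comes from the unique monomial of `f`
   maximising `Σ αᵢ M^{i+1} + j`), so `z` is integral over `k[y']`; general position
   `f'(ȳ', X) ≠ 0` is automatic (in `f^ρ(ȳ'₀ - X^{N₀}, …, X)` at `X = z̄ + ε` the exponents
   `Σ αᵢ M^{i+1} + j` of `ε` are pairwise distinct for `αᵢ, j < M`, using `(z̄+ε)^{Nᵢ} = z̄^{Nᵢ} + ε^{Nᵢ}`);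
   and if `f(ȳ, X) ≠ 0` with `z̄` a root of multiplicity `s ≤ deg f < M`, the least exponent is
   `s` itself, so `s' = s` EXACTLY.  Separability: `dy'ᵢ = dyᵢ` since `p ∣ Nᵢ`; if `K/k(y)` is
   inseparable one index must instead take `p ∤ N_{i₀}` (previous refuter's note), trading exact
   axis control for `s' ≤ s` bookkeeping — still paper-true for `n = 1`.  HENCE the crux is
   equivalent to its separability + defect core: every frame is dominated by an integral
   general-position frame of axis order `≤ s` whose projection is separable and defectless AT `O`.
2. DEFECT IS AUTOMATIC at (a) Abhyankar places — `(k(y'), O ∩ k(y'))` has transcendence defect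
   `0`, so it is a defectless field by generalized stability (tree `Kuhlmann2010Stability_holds`;
   route support `AbhyankarProjectionsDefectless`); this covers `n = 1` entirely; (b) DISCRETE
   rank-one places (value group `ℤ`, any `n`, e.g. arc valuations `f ↦ ord_t f(t, ξ(t))`): for
   `F = k(y')`, `Fʰ = F^sep ∩ F̂` is separably closed in `F̂`, so the minimal polynomial over `Fʰ`
   of a SEPARABLE `z'` stays irreducible over `F̂` (a proper factor would have coefficients
   separable-algebraic over `Fʰ` inside `F̂`), whence `[Kʰ : Fʰ] = [K̂ : F̂] = e·f` (complete
   discretely valued, separable ⇒ defectless).  Inseparable `z'` CAN carry defect there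
   (`F = k(u, b^p) ⊂ k((u))`, `K = F(b)`: immediate of degree `p`) — excluded by the separability
   conjunct, consistent with §B/§D.
3. OPEN CONTENT = `n ≥ 2`, `s ≥ 2`, NON-DISCRETE non-Abhyankar rank-one zero-dimensional places
   (rational rank 1 with non-discrete value group ⊂ ℚ, or transcendence defect with higher
   rational rank): elimination of defect by RE-CHOOSING the transcendence basis inside `O`
   without extending `K`.  In print: Knaf–Kuhlmann 2009 (defect removed after a finite extension
   of `K`), Temkin 2013 (after a purely inseparable one), Cutkosky–Mourtada 2019 (defectless
   projection ASSUMED, Thm 7.1), Kuhlmann 2010 §1.2 (posed).  A kill needs ONE frame at such a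
   place ALL of whose dominating integral re-framings of axis order `≤ s` are inseparable or have
   defect at `O`; the known defect examples (Cutkosky–Piltant 2004, Cutkosky 2015, ElHitti–Ghezzi,
   Kuhlmann's dependent Artin–Schreier defect towers) fix the subfield `k(y)` and say nothing about
   re-framings, and the ideators' worked example (frame `(t, ξ; tθ)` of `K = k(θ, ξ)`, defect `p`
   over `k(t, ξ)`) becomes henselian-generated over `k(t, ξ + λz)` for every `λ ≠ 0`
   (mixing_check2.py on the item) — i.e. the only computed instance goes the crux's way.
4. NO CERTIFIED-COMPUTE FORM: deciding defect of `K/k(y')` at a non-discrete place needs the full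
   MacLane–Vaquié key-polynomial chain of `z'` over `k(y')ʰ` (infinite for defect), and "for all
   re-framings" is a quantifier over an infinite-dimensional family; no finite search refutes it.
5. NEAR-MISSES: none formalisable this cycle (every candidate witness frame found on paper admits
   a defectless separable re-framing).
-/

/-! ## §D  A natural strengthening is false: the transcendence basis `y` MUST be re-chosen -/

/-- `DefectlessFramesR` with the conjunct `y' = y` ADDED to the conclusion (only `z` and `f` may be
re-chosen; everything else verbatim). [folklore] -/
def DefectlessFramesRFixedY : Prop :=
  ∀ p : ℕ, p.Prime → ∀ (k K : Type) [Field k] [CharP k p] [PerfectField k] [Field K] [Algebra k K], (⊤ : IntermediateField k K).FG → ∀ O : ValuationSubring K, ∀ hk : (∀ c : k, algebraMap k K c ∈ O), Nonempty O.valuation.RankOne → (∀ x ∈ O, ∃ f : Polynomial k, f ≠ 0 ∧ Polynomial.aeval x f ∈ O.nonunits) → let ρ : k →+* IsLocalRing.ResidueField O := (IsLocalRing.residue O).comp ((algebraMap k K).codRestrict O hk); let axis : (m : ℕ) → (Fin m → O) → MvPolynomial (Fin (m + 1)) k → Polynomial (IsLocalRing.ResidueField O) := fun _ w g => MvPolynomial.eval₂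 (Polynomial.C.comp ρ) (Fin.snoc (fun j => Polynomial.C (IsLocalRing.residue O (w j))) Polynomial.X) g; ∀ (n : ℕ) (y : Fin n → O) (z : O) (f : MvPolynomial (Fin (n + 1)) k), AlgebraicIndependent k (fun i => (y i : K)) → IntermediateField.adjoin k (Set.range (fun i => (y i : K)) ∪ {(z : K)}) = ⊤ → Ideal.span {f} = RingHom.ker (MvPolynomial.aeval (Fin.snoc (fun i => (y i : K)) (z : K)) : MvPolynomial (Fin (n + 1)) k →ₐ[k] K) → f ≠ 0 → ∃ (y' : Fin n → O) (z' : O) (f' : MvPolynomial (Fin (n + 1)) k), y' = y ∧ AlgebraicIndependent k (fun i => (y' i : K)) ∧ IsIntegral (Algebra.adjoin k (Set.range fun i => (y' i : K))) (z' : K) ∧ IntermediateField.adjoin k (Set.range (fun i => (y' i : K)) ∪ {(z' : K)}) = ⊤ ∧ Ideal.span {f'} = RingHom.ker (MvPolynomial.aeval (Fin.snoc (fun i => (y' i : K)) (z' : K)) : MvPolynomial (Fin (n + 1)) k →ₐ[k] K) ∧ (∀ i, (y i : K) ∈ Algebra.adjoin k (Set.range (fun i => (y' i : K)) ∪ {(z'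 : K)})) ∧ (z : K) ∈ Algebra.adjoin k (Set.range (fun i => (y' i : K)) ∪ {(z' : K)}) ∧ axis n y' f' ≠ 0 ∧ (axis n y f ≠ 0 → (axis n y' f').rootMultiplicity (IsLocalRing.residue O z') ≤ (axis n y f).rootMultiplicity (IsLocalRing.residue O z)) ∧ IsSeparable (IntermediateField.adjoin k (Set.range fun i => (y' i : K))) (z' : K) ∧ ∀ (Ω : Type) [Field Ω] [Algebra K Ω] [IsAlgClosure K Ω] (V : ValuationSubring Ω), V.comap (algebraMap K Ω) = O → let F : Subfield Ω := (IntermediateField.adjoin k (Set.range fun i => (y' i : K))).toSubfield.map (algebraMap K Ω); let Fh : Subfield Ω := (IntermediateField.lift (IntermediateField.fixedField (ValuationSubring.decompositionSubgroup F (V.comap (algebraMap (separableClosure F Ω) Ω))))).toSubfield; let T : Subfield Ω := Fh ⊔ (algebraMap K Ω).fieldRange; Fh ≤ T ∧ 0 < Subfield.relfinrank Fh T ∧ Subfield.relfinrank Fh T = (Literature.AlgebraicGeometry.Resolution.valueSubgroup Fh V).relIndex (Literature.AlgebraicGeometry.Resolution.valueSubgroup T V) * (Literature.AlgebraicGeometry.Resolution.residueSubfield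 Fh V).relfinrank (Literature.AlgebraicGeometry.Resolution.residueSubfield T V)

/-- Division with remainder by `X₁² - b(X₀)` in `k[X₀, X₁]`. [folklore] -/
theorem div_sq_sub_aeval {k : Type} [Field k] (b : Polynomial k) (g : MvPolynomial (Fin (1 + 1)) k) :
    ∃ (q : MvPolynomial (Fin (1 + 1)) k) (r₀ r₁ : Polynomial k),
      g = q * (MvPolynomial.X 1 ^ 2 - Polynomial.aeval (MvPolynomial.X 0) b) +
        Polynomial.aeval (MvPolynomial.X 0) r₀ + Polynomial.aeval (MvPolynomial.X 0) r₁ * MvPolynomial.X 1 := by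
  induction g using MvPolynomial.induction_on with
  | C c =>
    refine ⟨0, Polynomial.C c, 0, ?_⟩
    simp [MvPolynomial.algebraMap_eq]
  | add p q hp hq =>
    obtain ⟨q₁, r₀, r₁, rfl⟩ := hp
    obtain ⟨q₂, s₀, s₁, rfl⟩ := hq
    refine ⟨q₁ + q₂, r₀ + s₀, r₁ + s₁, ?_⟩
    simp only [map_add]
    ring
  | mul_X p i hp =>
    obtain ⟨q, r₀, r₁, rfl⟩ := hp
    fin_cases i
    · refine ⟨q * MvPolynomial.X 0, r₀ * Polynomial.X, r₁ * Polynomial.X, ?_⟩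
      simp only [Fin.zero_eta, map_mul, Polynomial.aeval_X]
      ring
    · refine ⟨q * MvPolynomial.X 1 + Polynomial.aeval (MvPolynomial.X 0) r₁, b * r₁, r₀, ?_⟩
      simp only [Fin.mk_one, map_mul]
      ring

/-- In characteristic `2`, `r₀(T²) + r₁(T²)·T = 0` forces `r₀ = r₁ = 0` (differentiate:
`d/dT` kills `r₀(T²)` and `r₁(T²)`, leaving `r₁(T²) = 0`). [folklore] -/
theorem expand_two_add_expand_two_mul_X {k : Type} [Field k] [CharP k 2] (r₀ r₁ : Polynomial k)
    (h : Polynomial.expand k 2 r₀ + Polynomial.expand k 2 r₁ * Polynomial.X = 0) : r₀ = 0 ∧ r₁ = 0 := by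
  have h2 : ((2 : ℕ) : Polynomial k) = 0 := CharP.cast_eq_zero _ 2
  have hd := congrArg Polynomial.derivative h
  rw [Polynomial.derivative_add, Polynomial.derivative_mul, Polynomial.derivative_expand,
    Polynomial.derivative_expand, h2, zero_mul, mul_zero, mul_zero, zero_mul, zero_add, zero_add,
    Polynomial.derivative_X, mul_one, Polynomial.derivative_zero, Polynomial.expand_eq_zero two_pos] at hd
  refine ⟨?_, hd⟩
  rwa [hd, map_zero, zero_mul, add_zero, Polynomial.expand_eq_zero two_pos] at h

/-- **Re-choosing only `z` does not suffice** (`DefectlessFramesRFixedY` is false, over the PERFECT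
field `𝔽₂`): the genuine frame `K = 𝔽₂(τ)`, `O` the `τ`-adic ring, `n = 1`, `y₀ = τ²`, `z = τ`,
`f = X₁² - X₀` (axis order `s = 2 = p`) meets every hypothesis of the crux, but `K/k(y₀)` is purely
inseparable, so NO `z'` generating `K` over `k(y₀)` is separable: `τ` separable over `k(τ²)` with
`τ² ∈ k(τ²)` gives `τ ∈ k(τ²)`, `τ·s(τ²) = r(τ²)` in `k[τ]`, and differentiating gives `s = 0`.
So any proof of `DefectlessFramesR` must move the transcendence basis (Zariski A.IV / Nagata
twist `y' = y + z^N`), not only the primitive element.  By-product: the hypotheses of the crux are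
met by a genuine frame with `n = 1`, `s = 2` (non-vacuity certificate). [folklore] -/
theorem defectlessFramesR_false_with_fixed_y : ¬ DefectlessFramesRFixedY := by
  intro h
  classical
  have h1 := h 2 Nat.prime_two (ZMod 2) (RatFunc (ZMod 2)) (fg_top _) OX[ZMod 2] (const_mem_OX _)
    (rankOne_OX _) (zeroDim_OX _)
  -- the frame `y₀ = τ²`, `z = τ`, `f = X₁² - X₀`
  have hτ2 : (RatFunc.X : RatFunc (ZMod 2)) ^ 2 ∈ OX[ZMod 2] := pow_mem (X_mem_OX _) 2
  let y : Fin 1 → OX[ZMod 2] := fun _ => ⟨RatFunc.X ^ 2, hτ2⟩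
  let z : OX[ZMod 2] := ⟨RatFunc.X, X_mem_OX _⟩
  have hy : AlgebraicIndependent (ZMod 2) (fun i => ((y i : OX[ZMod 2]) : RatFunc (ZMod 2))) := by
    rw [algebraicIndependent_singleton_iff (0 : Fin 1)]
    exact RatFunc.transcendental_X.pow two_pos
  have hadj : IntermediateField.adjoin (ZMod 2) (Set.range (fun i => ((y i : OX[ZMod 2]) : RatFunc (ZMod 2))) ∪
      {((z : OX[ZMod 2]) : RatFunc (ZMod 2))}) = ⊤ := by
    rw [eq_top_iff, ← RatFunc.adjoin_X]
    exact IntermediateField.adjoin.mono _ _ _ Set.subset_union_right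
  have hv0 : (Fin.snoc (fun i => ((y i : OX[ZMod 2]) : RatFunc (ZMod 2))) ((z : OX[ZMod 2]) : RatFunc (ZMod 2)) :
      Fin (1 + 1) → RatFunc (ZMod 2)) 0 = RatFunc.X ^ 2 := rfl
  have hv1 : (Fin.snoc (fun i => ((y i : OX[ZMod 2]) : RatFunc (ZMod 2))) ((z : OX[ZMod 2]) : RatFunc (ZMod 2)) :
      Fin (1 + 1) → RatFunc (ZMod 2)) 1 = RatFunc.X := rfl
  have hf0 : MvPolynomial.aeval (Fin.snoc (fun i => ((y i : OX[ZMod 2]) : RatFunc (ZMod 2)))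
      ((z : OX[ZMod 2]) : RatFunc (ZMod 2)) : Fin (1 + 1) → RatFunc (ZMod 2))
      (MvPolynomial.X 1 ^ 2 - MvPolynomial.X 0 : MvPolynomial (Fin (1 + 1)) (ZMod 2)) = 0 := by
    rw [map_sub, map_pow, MvPolynomial.aeval_X, MvPolynomial.aeval_X, hv0, hv1, sub_self]
  have hker : Ideal.span {(MvPolynomial.X 1 ^ 2 - MvPolynomial.X 0 : MvPolynomial (Fin (1 + 1)) (ZMod 2))} =
      RingHom.ker (MvPolynomial.aeval (Fin.snoc (fun i => ((y i : OX[ZMod 2]) : RatFunc (ZMod 2)))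
        ((z : OX[ZMod 2]) : RatFunc (ZMod 2))) : MvPolynomial (Fin (1 + 1)) (ZMod 2) →ₐ[ZMod 2] RatFunc (ZMod 2)) := by
    apply le_antisymm
    · rw [Ideal.span_le, Set.singleton_subset_iff, SetLike.mem_coe, RingHom.mem_ker]
      exact hf0
    · intro g hg
      rw [RingHom.mem_ker] at hg
      obtain ⟨q, r₀, r₁, rfl⟩ := div_sq_sub_aeval Polynomial.X g
      rw [Polynomial.aeval_X] at hg ⊢
      rw [map_add, map_add, map_mul, map_mul, hf0, mul_zero, zero_add, ← Polynomial.aeval_algHom_apply,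
        ← Polynomial.aeval_algHom_apply, MvPolynomial.aeval_X, MvPolynomial.aeval_X, hv0, hv1,
        ← Polynomial.expand_aeval, ← Polynomial.expand_aeval,
        RatFunc.aeval_X_left_eq_algebraMap, RatFunc.aeval_X_left_eq_algebraMap, ← RatFunc.algebraMap_X,
        ← map_mul, ← map_add, map_eq_zero_iff _ (RatFunc.algebraMap_injective (ZMod 2))] at hg
      obtain ⟨hr₀, hr₁⟩ := expand_two_add_expand_two_mul_X r₀ r₁ hg
      simp only [hr₀, hr₁, map_zero, zero_mul, add_zero]
      exact Ideal.mul_mem_left _ q (Ideal.subset_span rfl)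
  have hf : (MvPolynomial.X 1 ^ 2 - MvPolynomial.X 0 : MvPolynomial (Fin (1 + 1)) (ZMod 2)) ≠ 0 := by
    intro h0
    have := congrArg (MvPolynomial.eval (Fin.snoc (fun _ : Fin 1 => (1 : ZMod 2)) 0 : Fin (1 + 1) → ZMod 2)) h0
    rw [map_sub, map_pow, MvPolynomial.eval_X, MvPolynomial.eval_X, map_zero] at this
    exact absurd this (by decide)
  obtain ⟨y', z', f', hyy, -, -, hadj', -, -, -, -, -, hsep, -⟩ := h1 1 y z _ hy hadj hker hf
  subst hyy
  -- `F₁ = k(τ²)`, `K = F₁(z')` with `z'` separable, so `τ` is separable over `F₁`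
  generalize hF₁ : IntermediateField.adjoin (ZMod 2)
    (Set.range fun i => ((y i : OX[ZMod 2]) : RatFunc (ZMod 2))) = F₁ at hsep
  have hzt : IntermediateField.adjoin F₁ {((z' : OX[ZMod 2]) : RatFunc (ZMod 2))} = ⊤ := by
    rw [← IntermediateField.restrictScalars_eq_top_iff (K := ZMod 2),
      IntermediateField.restrictScalars_adjoin, eq_top_iff, ← hadj', ← hF₁]
    exact IntermediateField.adjoin.mono _ _ _
      (Set.union_subset_union_left _ (IntermediateField.subset_adjoin _ _))
  haveI hKsep : Algebra.IsSeparable F₁ (IntermediateField.adjoin F₁ {((z' : OX[ZMod 2]) : RatFunc (ZMod 2))}) :=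
    (IntermediateField.isSeparable_adjoin_simple_iff_isSeparable (F := F₁) (E := RatFunc (ZMod 2))).mpr hsep
  have hsepτ : IsSeparable F₁ (RatFunc.X : RatFunc (ZMod 2)) := by
    have hτ_top : (RatFunc.X : RatFunc (ZMod 2)) ∈
        IntermediateField.adjoin F₁ {((z' : OX[ZMod 2]) : RatFunc (ZMod 2))} := by
      rw [hzt]; exact IntermediateField.mem_top
    exact IntermediateField.isSeparable_of_mem_isSeparable (F := F₁) (E := RatFunc (ZMod 2)) hτ_top
  -- `τ² ∈ F₁`: separable and purely inseparable, hence `τ ∈ F₁`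
  have hτF : (RatFunc.X : RatFunc (ZMod 2)) ∈ F₁ := by
    have h1' : (RatFunc.X : RatFunc (ZMod 2)) ∈ separableClosure F₁ (RatFunc (ZMod 2)) :=
      mem_separableClosure_iff.mpr hsepτ
    have h2' : (RatFunc.X : RatFunc (ZMod 2)) ∈ perfectClosure F₁ (RatFunc (ZMod 2)) := by
      rw [mem_perfectClosure_iff_pow_mem 2]
      have hmem : (RatFunc.X : RatFunc (ZMod 2)) ^ 2 ∈ F₁ := by
        rw [← hF₁]
        exact IntermediateField.subset_adjoin _ _ ⟨0, rfl⟩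
      exact ⟨1, ⟨⟨_, hmem⟩, by rw [pow_one]; rfl⟩⟩
    have h3 : (RatFunc.X : RatFunc (ZMod 2)) ∈
        separableClosure F₁ (RatFunc (ZMod 2)) ⊓ perfectClosure F₁ (RatFunc (ZMod 2)) :=
      IntermediateField.mem_inf.mpr ⟨h1', h2'⟩
    rw [separableClosure_inf_perfectClosure, IntermediateField.mem_bot] at h3
    obtain ⟨w, hw⟩ := h3
    rw [← hw]
    exact w.2
  -- `τ ∈ k(τ²)`: write `τ = r(τ²)/s(τ²)` and differentiate `τ·s(τ²) = r(τ²)`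
  have hrange' : Set.range (fun i => ((y i : OX[ZMod 2]) : RatFunc (ZMod 2))) =
      {(RatFunc.X : RatFunc (ZMod 2)) ^ 2} := by
    rw [Set.range_unique]
  rw [← hF₁, hrange', IntermediateField.mem_adjoin_simple_iff] at hτF
  obtain ⟨r, s, hrs⟩ := hτF
  by_cases hs : Polynomial.aeval ((RatFunc.X : RatFunc (ZMod 2)) ^ 2) s = 0
  · rw [hs, div_zero] at hrs
    exact RatFunc.X_ne_zero hrs
  · rw [eq_div_iff hs, ← Polynomial.expand_aeval, ← Polynomial.expand_aeval,
      RatFunc.aeval_X_left_eq_algebraMap, RatFunc.aeval_X_left_eq_algebraMap, ← RatFunc.algebraMap_X,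
      ← map_mul, (RatFunc.algebraMap_injective (ZMod 2)).eq_iff] at hrs
    -- hrs : X * expand 2 s = expand 2 r in k[T]
    have hE : Polynomial.expand (ZMod 2) 2 (-r) + Polynomial.expand (ZMod 2) 2 s * Polynomial.X = 0 := by
      rw [map_neg, ← hrs]; ring
    obtain ⟨-, hs0⟩ := expand_two_add_expand_two_mul_X (-r) s hE
    exact hs (by rw [hs0, map_zero])

end

end Summit.ResolutionOfSingularities.ResolutionOfSingularities.Cruxes.DefectlessFramesR.Disproof
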